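import Mathlib
import Literature.AlgebraicGeometry.Resolution.TameQuotientSingularitiesResolution
import Summits.ResolutionOfSingularities.ResolutionOfSingularities.Theorems.IndSmoothValuativeSmoothingSmoothBlowupChart
import Literature.AlgebraicGeometry.Resolution.ComponentGluing
import HarnessLib

/-!
# Tame transfer — étale charts by tame quotients of REGULAR algebras
(crux stmt-ResolutionOfSingularities-15640 `WildQuotients.WildQuotientResolution`, line `Sketch`, lead res-L1-w45c-lead-1)

[OURS · L1 W4.5c] The stack-free form of the "stacky Király–Lütkebohmert transfer" (c7 `V4-RESOLUTION.md` §3,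
c8 HANDOFF step 3): if `g : Y₁ → X₁` is proper birational and every point of `Y₁` has an étale `k`-chart
`Spec S₀ → Y₁` (resp. `Spec S^H → Y₁`) where `S` is a finitely generated REGULAR `k`-algebra graded by a finite
abelian group (resp. acted on by a finite group `H` of order invertible in `k`), then `X₁` has a resolution —
conditional on the named fact Bergh–Rydh 2019 Thm 5 (`BerghRydh2019_diagonalizableQuotientResolution`, resp.
`BerghRydh2019_tameQuotientResolution`). Over the perfect field `k`, "regular of finite type" = "smooth"
(`ValuativeSmoothing.smooth_of_isRegularRing_of_perfectField`, already in the tree — the registered stub W1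
`smooth_of_isRegularRing_of_perfectField` of this skeleton is that declaration verbatim and is discharged by citation).
In the application `S = U^σ̃` is the fixed ring of the order-`p` lift on an étale chart `U` of a weighted blow-up in
the Király–Lütkebohmert terminal state (regular by `CyclicTransfer.isRegularRing_eqLocus`), graded by the weights.
NOT a statement of the manuscript. Statements and proofs: res-L1-w45c-lead-1 (`L/res-L1-w45c-lead-1/stubs/TameTransfer.lean`,
2026-08-26T17:3xZ, rc 0 modulo W1); landed for the chain by res-L1-w45c-stub-2 with W1 := the tree declaration. The
composites with Király–Lütkebohmert chart rings `S = U^⟨σ⟩` are `tameStackyCyclicTransfer[Graded]`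
(`Theorems/WildQuotientsWildQuotientResolutionTameStackyCyclicTransfer.lean`).
-/

-- single-problem summit: the doubled namespace component `ResolutionOfSingularities` is forced

set_option linter.dupNamespace false

noncomputable section

open CategoryTheory AlgebraicGeometry
open Literature.AlgebraicGeometry.Resolution


namespace Summit.ResolutionOfSingularities.ResolutionOfSingularities.Theorems.WildQuotientResolution.TameTransfer

/-- **Tame transfer, graded (diagonalizable) form** [OURS · L1 W4.5c]: over a perfect field `k`, if
`g : Y₁ → X₁` is proper and birational onto the integral separated finite-type `k`-scheme `X₁`, `Y₁` is
integral, and every point of `Y₁` lies in the image of an étale `k`-morphism `Spec S₀ → Y₁` where `S` is a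
finitely generated REGULAR `k`-algebra graded by a finite abelian group `A` (`Spec S₀ = Spec S / D(A)`), then
`X₁` has a resolution of singularities — conditional on Bergh–Rydh 2019 Thm 5 (diagonalizable case).
Proof: `S` is smooth over `k` (`ValuativeSmoothing.smooth_of_isRegularRing_of_perfectField`), so `Y₁` has finite tame quotient
singularities and a resolution by the named fact; compose with `g` (`ComponentGluing.Scheme.HasResolution.of_isBirational`).
[cite: BerghRydh2019, Thm 5] -/
theorem hasResolution_of_gradedRegularCharts
    (hBR : BerghRydh2019_diagonalizableQuotientResolution)
    (k : Type) [Field k] [PerfectField k] (X₁ Y₁ : Scheme.{0}) (f : X₁ ⟶ Spec (.of k))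
    [IsIntegral X₁] [IsSeparated f] [LocallyOfFiniteType f] [QuasiCompact f]
    (g : Y₁ ⟶ X₁) [IsProper g] (hbir : IsBirational g) [IsIntegral Y₁]
    (hchart : ∀ y : Y₁, ∃ (A : Type) (_ : AddCommGroup A) (_ : Finite A) (_ : DecidableEq A)
        (S : Type) (_ : CommRing S) (_ : Algebra k S) (𝒮 : A → Submodule k S)
        (_ : GradedAlgebra 𝒮), Algebra.FiniteType k S ∧ IsRegularRing S ∧
        ∃ φ : Spec (.of (𝒮 0)) ⟶ Y₁, Etale φ ∧ y ∈ Set.range φ ∧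
          φ ≫ g ≫ f = Spec.map (CommRingCat.ofHom (algebraMap k (𝒮 0)))) :
    Scheme.HasResolution X₁ := by
  haveI : IsSeparated (g ≫ f) := inferInstance
  haveI : LocallyOfFiniteType (g ≫ f) := inferInstance
  haveI : QuasiCompact (g ≫ f) := inferInstance
  refine ComponentGluing.Scheme.HasResolution.of_isBirational g hbir (hBR k Y₁ (g ≫ f) fun y => ?_)
  obtain ⟨A, iA, iF, iD, S, iR, iAlg, 𝒮, iG, hft, hreg, φ, hφ, hy, hcomm⟩ := hchart y
  haveI := hft
  haveI := hreg
  exact ⟨A, iA, iF, iD, S, iR, iAlg, 𝒮, iG, hft, ValuativeSmoothing.smooth_of_isRegularRing_of_perfectField k S, φ, hφ, hy,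
    hcomm⟩

/-- **Tame transfer, constant-group form** [OURS · L1 W4.5c]: over a perfect field `k`, if `g : Y₁ → X₁` is
proper and birational onto the integral separated finite-type `k`-scheme `X₁`, `Y₁` is integral, and every
point of `Y₁` lies in the image of an étale `k`-morphism `Spec S^H → Y₁` where `S` is a finitely generated
REGULAR `k`-algebra and `H` a finite group of order invertible in `k` acting on `S` by `k`-algebra
automorphisms, then `X₁` has a resolution of singularities — conditional on Bergh–Rydh 2019 Thm 5
(constant tame groups). [cite: BerghRydh2019, Thm 5] -/
theorem hasResolution_of_tameRegularCharts
    (hBR : BerghRydh2019_tameQuotientResolution)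
    (k : Type) [Field k] [PerfectField k] (X₁ Y₁ : Scheme.{0}) (f : X₁ ⟶ Spec (.of k))
    [IsIntegral X₁] [IsSeparated f] [LocallyOfFiniteType f] [QuasiCompact f]
    (g : Y₁ ⟶ X₁) [IsProper g] (hbir : IsBirational g) [IsIntegral Y₁]
    (hchart : ∀ y : Y₁, ∃ (H : Type) (_ : Group H) (_ : Finite H) (S : Type) (_ : CommRing S)
        (_ : Algebra k S) (_ : MulSemiringAction H S) (_ : SMulCommClass H k S),
        (Nat.card H : k) ≠ 0 ∧ Algebra.FiniteType k S ∧ IsRegularRing S ∧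
        ∃ φ : Spec (.of (FixedPoints.subalgebra k S H)) ⟶ Y₁, Etale φ ∧ y ∈ Set.range φ.base ∧
          φ ≫ g ≫ f = Spec.map (CommRingCat.ofHom (algebraMap k (FixedPoints.subalgebra k S H)))) :
    Scheme.HasResolution X₁ := by
  haveI : IsSeparated (g ≫ f) := inferInstance
  haveI : LocallyOfFiniteType (g ≫ f) := inferInstance
  haveI : QuasiCompact (g ≫ f) := inferInstance
  refine ComponentGluing.Scheme.HasResolution.of_isBirational g hbir (hBR k Y₁ (g ≫ f) fun y => ?_)
  obtain ⟨H, iGrp, iF, S, iR, iAlg, iM, iS, hH, hft, hreg, φ, hφ, hy, hcomm⟩ := hchart y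
  haveI := hft
  haveI := hreg
  have hsm : Algebra.Smooth k S := ValuativeSmoothing.smooth_of_isRegularRing_of_perfectField k S
  exact ⟨H, iGrp, iF, S, iR, iAlg, iM, iS, hH, hft, hsm, φ, hφ, hy, hcomm⟩

end Summit.ResolutionOfSingularities.ResolutionOfSingularities.Theorems.WildQuotientResolution.TameTransfer

end
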